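import Literature.Barriers.Parity.SiegelZeroDichotomyPairHLProp81Errors
import HarnessLib

/-!
# Tao–Teräväinen 2022, §8 (`k = 2`): absorption of polylogarithmic losses over Siegel zeros

Topic `Literature/Barriers/Parity`, sub-namespace `TaoTeravainen`; bookkeeping for the final assembly of
`Literature.Barriers.Parity.TaoTeravainen2021_prop72_81_pair` (T. Tao, J. Teräväinen, *The
Hardy–Littlewood–Chowla conjecture in the presence of a Siegel zero*, J. London Math. Soc. (2) 106 (2022),
arXiv:2109.06291), §2 ("we use `X ≈ Y` to denote `X = Y + O(log^{-c} η)`"; (1.4) `η ≪_ε q^ε`; (2.3)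
`q^{20.5} ≤ x ≤ q^{√η}`-type ranges). On the range `q^{41/2} ≤ x ≤ q^{√η}` over Siegel zeros every loss
`(1 + log x)^k` is absorbed by any power saving in `q` or in `x`. Everything here is PROVED:

* `exists_absorb_rpow_conductor` — `(1+log x)^k q^{-a} ≤ K/log^{1/20} η`;
* `exists_absorb_rpow_x` — `(1+log x)^k x^{-a} ≤ K/log^{1/20} η`;
* `exists_absorb_log_x` — `(log x)^{-7/10} ≤ K/log^{1/20} η`;
* `exists_eta_threshold_conductor` — for every `Q`, all Siegel zeros with `η ≥ η₁(Q)` have `q ≥ Q`;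
* `log_eta_rpow_neg_le` — `(log η)^{-a} ≤ (log η)^{-1/20}` for `a ≥ 1/20`. [cite: TaoTeravainen2021, §2 and (1.4)]
-/

noncomputable section

open Real

namespace Literature.Barriers.Parity

namespace TaoTeravainen

/-- **`(1 + log x)^k q^{-a} ≤ K/log^{1/20} η`** on `1 ≤ x ≤ q^{√η}` over Siegel zeros (`a > 0`).
[cite: TaoTeravainen2021, §2 and (1.4)] -/
theorem exists_absorb_rpow_conductor (k : ℕ) {a : ℝ} (ha : 0 < a) :
    ∃ K : ℝ, 0 ≤ K ∧ ∀ (q : ℕ) [NeZero q] (χ : DirichletCharacter ℂ q) (η : ℝ), IsSiegelZero χ η →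
      ∀ x : ℝ, 1 ≤ x → x ≤ (q : ℝ) ^ Real.sqrt η →
        (1 + Real.log x) ^ k * (q : ℝ) ^ (-a) ≤ K / Real.log η ^ ((1 : ℝ) / 20) := by
  have hγ : 0 < a / (2 * (k + 1)) := by positivity
  obtain ⟨K₁, hK₁1, hK₁⟩ := exists_one_add_log_le_rpow hγ
  obtain ⟨K₂, hK₂0, hK₂⟩ := exists_rpow_neg_le_div_twentieth (half_pos ha)
  refine ⟨K₁ ^ k * K₂, by positivity, fun q _ χ η h x hx1 hxq => ?_⟩
  have hq1 : (1 : ℝ) ≤ q := by exact_mod_cast NeZero.one_le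
  have hq0 : (0 : ℝ) < q := by linarith
  have h1 := hK₁ q χ η h x hx1 hxq
  have hlog0 : 0 ≤ 1 + Real.log x := by have := Real.log_nonneg hx1; linarith
  -- `(1 + log x)^k ≤ K₁^k q^{a/2}`
  have h2 : (1 + Real.log x) ^ k ≤ K₁ ^ k * (q : ℝ) ^ (a / 2) := by
    calc (1 + Real.log x) ^ k ≤ (K₁ * (q : ℝ) ^ (a / (2 * (k + 1)))) ^ k := pow_le_pow_left₀ hlog0 h1 k
      _ = K₁ ^ k * (q : ℝ) ^ (a / (2 * (k + 1)) * k) := by rw [mul_pow, ← Real.rpow_natCast ((q : ℝ) ^ _) k, ← Real.rpow_mul hq0.le]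
      _ ≤ K₁ ^ k * (q : ℝ) ^ (a / 2) := by
          refine mul_le_mul_of_nonneg_left (Real.rpow_le_rpow_of_exponent_le hq1 ?_) (by positivity)
          rw [div_mul_eq_mul_div, div_le_div_iff₀ (by positivity) two_pos]
          have hk : (0 : ℝ) ≤ k := Nat.cast_nonneg k
          nlinarith
  have h3 := hK₂ q χ η h
  calc (1 + Real.log x) ^ k * (q : ℝ) ^ (-a) ≤ K₁ ^ k * (q : ℝ) ^ (a / 2) * (q : ℝ) ^ (-a) :=
        mul_le_mul_of_nonneg_right h2 (by positivity)
    _ = K₁ ^ k * (q : ℝ) ^ (-(a / 2)) := by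
        rw [mul_assoc, ← Real.rpow_add hq0]; congr 2; ring
    _ ≤ K₁ ^ k * (K₂ / Real.log η ^ ((1 : ℝ) / 20)) := mul_le_mul_of_nonneg_left h3 (by positivity)
    _ = K₁ ^ k * K₂ / Real.log η ^ ((1 : ℝ) / 20) := by ring

/-- **`(1 + log x)^k x^{-a} ≤ K/log^{1/20} η`** on `q^{41/2} ≤ x` over Siegel zeros (`a > 0`).
[cite: TaoTeravainen2021, §2 and (1.4)] -/
theorem exists_absorb_rpow_x (k : ℕ) {a : ℝ} (ha : 0 < a) :
    ∃ K : ℝ, 0 ≤ K ∧ ∀ (q : ℕ) [NeZero q] (χ : DirichletCharacter ℂ q) (η : ℝ), IsSiegelZero χ η →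
      ∀ x : ℝ, (q : ℝ) ^ ((41 : ℝ) / 2) ≤ x →
        (1 + Real.log x) ^ k * x ^ (-a) ≤ K / Real.log η ^ ((1 : ℝ) / 20) := by
  obtain ⟨K₂, hK₂0, hK₂⟩ := exists_rpow_neg_le_div_twentieth (show 0 < (41 : ℝ) / 2 * (a / 2) by positivity)
  refine ⟨(1 + k / (a / 2)) ^ k * K₂, by positivity, fun q _ χ η h x hx => ?_⟩
  have hq1 : (1 : ℝ) ≤ q := by exact_mod_cast NeZero.one_le
  have hq0 : (0 : ℝ) < q := by linarith
  have hx1 : 1 ≤ x := le_trans (Real.one_le_rpow hq1 (by norm_num)) hx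
  have hx0 : 0 < x := by linarith
  have h1 := one_add_log_pow_le_rpow hx1 (half_pos ha) k
  have h2 := rpow_neg_le_of_le_rpow hq1 hx (half_pos ha).le
  have h3 := hK₂ q χ η h
  calc (1 + Real.log x) ^ k * x ^ (-a) ≤ (1 + k / (a / 2)) ^ k * x ^ (a / 2) * x ^ (-a) :=
        mul_le_mul_of_nonneg_right h1 (by positivity)
    _ = (1 + k / (a / 2)) ^ k * x ^ (-(a / 2)) := by rw [mul_assoc, ← Real.rpow_add hx0]; congr 2; ring
    _ ≤ (1 + k / (a / 2)) ^ k * (q : ℝ) ^ (-((41 : ℝ) / 2 * (a / 2))) := mul_le_mul_of_nonneg_left h2 (by positivity)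
    _ ≤ (1 + k / (a / 2)) ^ k * (K₂ / Real.log η ^ ((1 : ℝ) / 20)) := mul_le_mul_of_nonneg_left h3 (by positivity)
    _ = _ := by ring

/-- **`(log x)^{-7/10} ≤ K/log^{1/20} η`** for `q^{41/2} ≤ x` over Siegel zeros. [cite: TaoTeravainen2021, (1.4)] -/
theorem exists_absorb_log_x :
    ∃ K : ℝ, 0 ≤ K ∧ ∀ (q : ℕ) [NeZero q] (χ : DirichletCharacter ℂ q) (η : ℝ), IsSiegelZero χ η →
      ∀ x : ℝ, (q : ℝ) ^ ((41 : ℝ) / 2) ≤ x →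
        Real.log x ^ (-(7 : ℝ) / 10) ≤ K / Real.log η ^ ((1 : ℝ) / 20) := by
  obtain ⟨K, hK0, hK⟩ := exists_log_conductor_rpow_neg_le
  refine ⟨K, hK0, fun q _ χ η h x hx => le_trans ?_ (hK q χ η h)⟩
  have hq3 : (3 : ℝ) ≤ q := by exact_mod_cast h.three_le
  have hq1 : (1 : ℝ) < q := by linarith
  have hlogq : 0 < Real.log q := Real.log_pos hq1
  -- `log q ≤ (41/2) log q = log(q^{41/2}) ≤ log x`
  have hxpos : 0 < (q : ℝ) ^ ((41 : ℝ) / 2) := by positivity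
  have hlogx : Real.log q ≤ Real.log x := by
    calc Real.log q ≤ (41 : ℝ) / 2 * Real.log q := by nlinarith
      _ = Real.log ((q : ℝ) ^ ((41 : ℝ) / 2)) := (Real.log_rpow (by linarith) _).symm
      _ ≤ Real.log x := Real.log_le_log hxpos hx
  exact Real.rpow_le_rpow_of_nonpos hlogq hlogx (by norm_num)

/-- **Large `η` forces large conductor**: for every `Q` there is `η₁` such that every Siegel zero with
`η ≥ η₁` has `Q ≤ q` (`log η ≤ log q + c`). [cite: TaoTeravainen2021, (1.4)] -/
theorem exists_eta_threshold_conductor (Q : ℝ) :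
    ∃ η₁ : ℝ, ∀ (q : ℕ) [NeZero q] (χ : DirichletCharacter ℂ q) (η : ℝ), IsSiegelZero χ η → η₁ ≤ η → Q ≤ q := by
  obtain ⟨c, hc⟩ := exists_log_le_mul_log_conductor_add one_pos
  refine ⟨Real.exp (Real.log (max Q 1) + c), fun q _ χ η h hη => ?_⟩
  have hq0 : (0 : ℝ) < q := by exact_mod_cast lt_of_lt_of_le (by norm_num) h.three_le
  have hη0 : 0 < η := lt_of_lt_of_le (by norm_num) h.ten_le
  have h1 := hc q χ η h
  rw [one_mul] at h1
  have h2 : Real.log (max Q 1) + c ≤ Real.log η := by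
    rw [← Real.log_exp (Real.log (max Q 1) + c)]
    exact Real.log_le_log (Real.exp_pos _) hη
  have h3 : Real.log (max Q 1) ≤ Real.log q := by linarith
  have h4 : max Q 1 ≤ q := by
    rwa [Real.log_le_log_iff (by positivity) hq0] at h3
  exact (le_max_left Q 1).trans h4

/-- `(log η)^{-a} ≤ (log η)^{-1/20}` for a Siegel zero and `a ≥ 1/20`. [folklore] -/
theorem log_eta_rpow_neg_le {q : ℕ} [NeZero q] {χ : DirichletCharacter ℂ q} {η : ℝ} (h : IsSiegelZero χ η)
    {a : ℝ} (ha : (1 : ℝ) / 20 ≤ a) {K : ℝ} (hK : 0 ≤ K) :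
    K * Real.log η ^ (-a) ≤ K / Real.log η ^ ((1 : ℝ) / 20) := by
  have hL1 := one_le_log_eta h
  rw [div_eq_mul_inv, ← Real.rpow_neg (by linarith)]
  exact mul_le_mul_of_nonneg_left (Real.rpow_le_rpow_of_exponent_le hL1 (by linarith)) hK

end TaoTeravainen

end Literature.Barriers.Parity
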